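import Summits.Ventures.PercRepro.S1TriangleKernelSevenLemmas

/-!
# PercRepro — THE TRIANGLE KERNEL AT NULLITY `7`, THE CASE `|U| = 13` (p8, gen 24; a feeder for S4 — the rows `≤ 36`
of the `q = 7` window)

`s₃ = 13` at nullity `7`, `m = 3` at `x`, `|U| = 13`, `r(U) = 6`, `Q = U ∖ St` with `6` points, some `q₀ ∈ Q` in
`cl(St)`. The outside points `O = U ∖ cl(St)` number `≥ 4` and `≤ 5` (`q₀ ∉ O`). For `q₁ ∈ O` the flat `F = cl(St ∪ {q₁})`
has rank `≤ 5 < 6 = r(U)`, so some point of `U` is off `F`, and `U ∖ F` has `≥ 4` points (`four_le_ncard_sdiff_closure`),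
all in `O ∖ {q₁}` (`cl(St) ⊆ F ∋ q₁`): `U ∖ F = O ∖ {q₁}`, four points. A triangle through `q₁` has a second point off
`cl(St)`, i.e. in `O ∖ {q₁} = U ∖ F`, and then its third point is off `F` too (in `F` it would drag the second into
`cl({q₁, z}) ⊆ F`): the three triangles through `q₁` carry three pairwise disjoint pairs of the four points of `U ∖ F`,
impossible (`false_of_thirteen`). Axioms: standard.
-/

open scoped Matroid

namespace PercRepro

namespace S1

open Set

variable {α : Type}

/-- **CASE `|U| = 13` of the kernel at nullity `7`**: with the three triangles through `x` (all of them), every point of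
`U` on `≥ 3` triangles, `|Q| = 6`, `r(U) = 6` and a point `q₀ ∈ Q ∩ cl(St)`, a contradiction. -/
theorem false_of_thirteen (M : Matroid α) [M.Finite]
    (hC1 : ∀ L ⊆ M.E, M.eRk L = 2 → L.ncard ≤ 3) {x : α} (hx : M.IsNonloop x)
    {Ci Cj Ck : Set α} (hCi : Ci ∈ ThmN.trianglesThrough M x) (hCj : Cj ∈ ThmN.trianglesThrough M x)
    (hCk : Ck ∈ ThmN.trianglesThrough M x) (hij : Ci ≠ Cj) (hik : Ci ≠ Ck) (hjk : Cj ≠ Ck)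
    (hmin3 : ∀ y ∈ ⋃₀ ThmN.triangles M, 3 ≤ (ThmN.trianglesThrough M y).ncard)
    (hQ6 : ((⋃₀ ThmN.triangles M) \ ({x} ∪ (Ci ∪ Cj ∪ Ck))).ncard = 6)
    (hr6 : M.eRk (⋃₀ ThmN.triangles M) = 6) {q₀ : α}
    (hq₀Q : q₀ ∈ (⋃₀ ThmN.triangles M) \ ({x} ∪ (Ci ∪ Cj ∪ Ck)))
    (hq₀cl : q₀ ∈ M.closure ({x} ∪ (Ci ∪ Cj ∪ Ck))) : False := by
  classical
  set S := ThmN.triangles M with hS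
  have hSfin : S.Finite :=
    M.ground_finite.finite_subsets.subset (fun C hC => hC.1.subset_ground)
  have hUE : ⋃₀ S ⊆ M.E := by
    intro z hz
    obtain ⟨C, hC, hzC⟩ := Set.mem_sUnion.1 hz
    exact hC.1.subset_ground hzC
  have hUfin : (⋃₀ S).Finite := M.ground_finite.subset hUE
  have hxU' : x ∈ ⋃₀ S := Set.mem_sUnion.2 ⟨Ci, ⟨hCi.1, hCi.2.1⟩, hCi.2.2⟩
  set s : Finset (Set α) := {Ci, Cj, Ck} with hsdef
  have hs : ∀ C ∈ s, C ∈ ThmN.trianglesThrough M x := by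
    intro C hC
    simp only [hsdef, Finset.mem_insert, Finset.mem_singleton] at hC
    rcases hC with rfl | rfl | rfl
    · exact hCi
    · exact hCj
    · exact hCk
  have hscard : s.card = 3 := Finset.card_eq_three.2 ⟨Ci, Cj, Ck, hij, hik, hjk, rfl⟩
  obtain ⟨hstar_rk, -⟩ := ThmN.eRk_le_and_ncard_eq_of_triangles M hC1 hx s hs
  rw [hscard] at hstar_rk
  set St := ({x} ∪ (Ci ∪ Cj ∪ Ck) : Set α) with hSt
  have hSteq : ({x} ∪ ⋃ C ∈ s, C) = St := by
    ext z
    constructor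
    · intro hz
      rcases hz with hz | hz
      · exact Or.inl hz
      · obtain ⟨C, hC, hzC⟩ := Set.mem_iUnion₂.1 hz
        simp only [hsdef, Finset.mem_insert, Finset.mem_singleton] at hC
        rcases hC with rfl | rfl | rfl
        · exact Or.inr (Or.inl (Or.inl hzC))
        · exact Or.inr (Or.inl (Or.inr hzC))
        · exact Or.inr (Or.inr hzC)
    · intro hz
      rcases hz with hz | hz
      · exact Or.inl hz
      · refine Or.inr ?_
        rcases hz with (hz | hz) | hz
        · exact Set.mem_iUnion₂.2 ⟨Ci, by simp [hsdef], hz⟩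
        · exact Set.mem_iUnion₂.2 ⟨Cj, by simp [hsdef], hz⟩
        · exact Set.mem_iUnion₂.2 ⟨Ck, by simp [hsdef], hz⟩
  rw [hSteq] at hstar_rk
  have hStU : St ⊆ ⋃₀ S := by
    intro z hz
    rcases hz with hz | hz
    · rw [Set.mem_singleton_iff.1 hz]; exact hxU'
    · rcases hz with (hz | hz) | hz
      · exact Set.mem_sUnion.2 ⟨Ci, ⟨hCi.1, hCi.2.1⟩, hz⟩
      · exact Set.mem_sUnion.2 ⟨Cj, ⟨hCj.1, hCj.2.1⟩, hz⟩
      · exact Set.mem_sUnion.2 ⟨Ck, ⟨hCk.1, hCk.2.1⟩, hz⟩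
  have hStE : St ⊆ M.E := hStU.trans hUE
  have hStcl' : St ⊆ M.closure St := M.subset_closure St hStE
  set Q := (⋃₀ S) \ St with hQ
  have hQfin : Q.Finite := hUfin.subset Set.sdiff_subset
  have hTU : ∀ T ∈ S, T ⊆ ⋃₀ S := fun T hT z hz => Set.mem_sUnion.2 ⟨T, hT, hz⟩
  -- the outside points `O`: at least four, at most five
  have hStcl : M.eRk (M.closure St) ≤ 4 := by
    rw [M.eRk_closure_eq]
    have h4 : ((1 + 3 : ℕ) : ℕ∞) = 4 := by norm_num
    rw [h4] at hstar_rk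
    exact hstar_rk
  have hexO : ∃ q ∈ ⋃₀ S, q ∉ M.closure St := by
    by_contra h
    push Not at h
    have hsub : ⋃₀ S ⊆ M.closure St := fun z hz => h z hz
    have h1 := M.eRk_mono hsub
    rw [hr6] at h1
    have h2 : (6 : ℕ∞) ≤ 4 := h1.trans hStcl
    have h3 : (6 : ℕ) ≤ 4 := by exact_mod_cast h2
    omega
  obtain ⟨q₁, hq₁U, hq₁cl⟩ := hexO
  set O := (⋃₀ S) \ M.closure St with hO
  have hOQ : O ⊆ Q := fun z hz => ⟨hz.1, fun h => hz.2 (hStcl' h)⟩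
  have hOfin : O.Finite := hUfin.subset Set.sdiff_subset
  have hq₀O : q₀ ∉ O := fun h => h.2 hq₀cl
  have hOsub : O ⊆ Q \ {q₀} := fun z hz => ⟨hOQ hz, fun h => hq₀O (Set.mem_singleton_iff.1 h ▸ hz)⟩
  have hO5 : O.ncard ≤ 5 := by
    have := Set.ncard_le_ncard hOsub (hQfin.subset Set.sdiff_subset)
    rw [Set.ncard_sdiff' (Set.singleton_subset_iff.2 hq₀Q) hQfin, hQ6, Set.ncard_singleton] at this
    exact this
  have hq₁O : q₁ ∈ O := ⟨hq₁U, hq₁cl⟩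
  -- the flat `F = cl(St ∪ {q₁})` of rank `≤ 5`, and `U ∖ F` with `≥ 4` points inside `O ∖ {q₁}`
  set X₁ := St ∪ {q₁} with hX₁
  set F := M.closure X₁ with hF
  have hX₁E : X₁ ⊆ M.E := Set.union_subset hStE (Set.singleton_subset_iff.2 (hUE hq₁U))
  have hFrk : M.eRk F ≤ 5 := by
    rw [hF, M.eRk_closure_eq]
    calc M.eRk X₁ ≤ M.eRk St + M.eRk {q₁} := M.eRk_union_le_eRk_add_eRk St {q₁}
      _ ≤ 4 + 1 := by
          have h4 : ((1 + 3 : ℕ) : ℕ∞) = 4 := by norm_num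
          rw [h4] at hstar_rk
          exact add_le_add hstar_rk (M.eRk_singleton_le q₁)
      _ = 5 := by norm_num
  have hexX : ∃ q₂ ∈ ⋃₀ S, q₂ ∉ F := by
    by_contra h
    push Not at h
    have hsub : ⋃₀ S ⊆ F := fun z hz => h z hz
    have h1 := M.eRk_mono hsub
    rw [hr6] at h1
    have h2 : (6 : ℕ∞) ≤ 5 := h1.trans hFrk
    have h3 : (6 : ℕ) ≤ 5 := by exact_mod_cast h2
    omega
  obtain ⟨q₂, hq₂U, hq₂F⟩ := hexX
  set OX := (⋃₀ S) \ F with hOX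
  have hOXfin : OX.Finite := hUfin.subset Set.sdiff_subset
  have hOX4 : 4 ≤ OX.ncard := four_le_ncard_sdiff_closure M hC1 hq₂U hq₂F (hmin3 q₂ hq₂U)
  have hclF : M.closure St ⊆ F := M.closure_subset_closure Set.subset_union_left
  have hq₁F : q₁ ∈ F := M.subset_closure X₁ hX₁E (Or.inr rfl)
  have hOXsub : OX ⊆ O \ {q₁} := by
    intro z hz
    refine ⟨⟨hz.1, fun h => hz.2 (hclF h)⟩, fun h => hz.2 (Set.mem_singleton_iff.1 h ▸ hq₁F)⟩
  have hOq₁ : (O \ {q₁}).ncard ≤ 4 := by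
    rw [Set.ncard_sdiff' (Set.singleton_subset_iff.2 hq₁O) hOfin, Set.ncard_singleton]
    omega
  have hOXeq : OX = O \ {q₁} :=
    Set.eq_of_subset_of_ncard_le hOXsub (hOq₁.trans hOX4) (hOfin.subset Set.sdiff_subset)
  have hOXcard : OX.ncard = 4 := by
    have := Set.ncard_le_ncard hOXsub (hOfin.subset Set.sdiff_subset)
    omega
  -- every triangle through `q₁` has its two other points off `F`
  have hT2 : ∀ T ∈ ThmN.trianglesThrough M q₁, T \ {q₁} ⊆ OX := by
    intro T hT z hz
    obtain ⟨y₀, hy₀T, hy₀q, hy₀cl⟩ := exists_mem_notMem_closure_of_notMem_closure M hq₁cl hT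
    have hy₀O : y₀ ∈ O \ {q₁} :=
      ⟨⟨hTU T ⟨hT.1, hT.2.1⟩ hy₀T, hy₀cl⟩, fun h => hy₀q (Set.mem_singleton_iff.1 h)⟩
    have hy₀F : y₀ ∉ F := by
      rw [← hOXeq] at hy₀O
      exact hy₀O.2
    have hzq : z ≠ q₁ := fun h => hz.2 (by rw [h]; exact Set.mem_singleton q₁)
    refine ⟨hTU T ⟨hT.1, hT.2.1⟩ hz.1, ?_⟩
    intro hzF
    -- `T ⊆ cl{q₁, z} ⊆ F`, against `y₀ ∉ F`
    have hTcl : T ⊆ F := by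
      refine (triangle_subset_closure_of_two_mem M ⟨hT.1, hT.2.1⟩ hT.2.2 hz.1 hzq.symm).trans ?_
      rw [hF]
      refine M.closure_subset_closure_of_subset_closure ?_
      intro w hw
      rcases hw with rfl | hw
      · exact hq₁F
      · rw [Set.mem_singleton_iff.1 hw]; exact hzF
    exact hy₀F (hTcl hy₀T)
  -- three triangles through `q₁`: three disjoint pairs in the four points of `U ∖ F`
  have hTqfin : (ThmN.trianglesThrough M q₁).Finite := hSfin.subset (fun C hC => ⟨hC.1, hC.2.1⟩)
  set 𝒯 : Finset (Set α) := hTqfin.toFinset with h𝒯def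
  have hmemq : ∀ T, T ∈ 𝒯 ↔ T ∈ ThmN.trianglesThrough M q₁ := fun T => Set.Finite.mem_toFinset hTqfin
  have hcardq : 3 ≤ 𝒯.card := by
    rw [h𝒯def, ← Set.ncard_eq_toFinset_card _ hTqfin]
    exact hmin3 q₁ hq₁U
  obtain ⟨𝒯₃, h𝒯₃sub, h𝒯₃card⟩ := Finset.exists_subset_card_eq hcardq
  set OXf : Finset α := hOXfin.toFinset with hOXfdef
  have hmemOX : ∀ z, z ∈ OXf ↔ z ∈ OX := fun z => Set.Finite.mem_toFinset hOXfin
  have hOXfcard : OXf.card = 4 := by rw [hOXfdef, ← Set.ncard_eq_toFinset_card _ hOXfin, hOXcard]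
  have hg2 : ∀ T ∈ 𝒯₃, 2 ≤ (OXf.filter (fun z => z ∈ T)).card := by
    intro T hT
    have hTq : T ∈ ThmN.trianglesThrough M q₁ := (hmemq T).1 (h𝒯₃sub hT)
    have hTfin : T.Finite := M.ground_finite.subset hTq.1.subset_ground
    have hD : (T \ {q₁}).Finite := hTfin.subset Set.sdiff_subset
    have hDcard : (T \ {q₁}).ncard = 2 := by
      rw [Set.ncard_sdiff' (Set.singleton_subset_iff.2 hTq.2.2) hTfin, hTq.2.1, Set.ncard_singleton]
    have hsub : hD.toFinset ⊆ OXf.filter (fun z => z ∈ T) := by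
      intro z hz
      rw [Set.Finite.mem_toFinset] at hz
      rw [Finset.mem_filter, hmemOX]
      exact ⟨hT2 T hTq hz, hz.1⟩
    have := Finset.card_le_card hsub
    rw [← Set.ncard_eq_toFinset_card _ hD, hDcard] at this
    exact this
  have hq₁OX : q₁ ∉ OX := fun h => h.2 hq₁F
  have hdisj : (↑𝒯₃ : Set (Set α)).PairwiseDisjoint (fun T => OXf.filter (fun z => z ∈ T)) := by
    intro T hT T' hT' hne
    rw [Function.onFun, Finset.disjoint_left]
    intro z hzT hzT'
    rw [Finset.mem_filter, hmemOX] at hzT hzT'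
    have hTq : T ∈ ThmN.trianglesThrough M q₁ := (hmemq T).1 (h𝒯₃sub (Finset.mem_coe.1 hT))
    have hT'q : T' ∈ ThmN.trianglesThrough M q₁ := (hmemq T').1 (h𝒯₃sub (Finset.mem_coe.1 hT'))
    have h := ThmN.inter_eq_singleton_of_mem_trianglesThrough M hC1 hTq hT'q hne
    have : z ∈ T ∩ T' := ⟨hzT.2, hzT'.2⟩
    rw [h] at this
    exact hq₁OX (Set.mem_singleton_iff.1 this ▸ hzT.1)
  have hbiU : 𝒯₃.biUnion (fun T => OXf.filter (fun z => z ∈ T)) ⊆ OXf := by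
    intro z hz
    obtain ⟨T, -, hzT⟩ := Finset.mem_biUnion.1 hz
    exact (Finset.mem_filter.1 hzT).1
  have h1 := Finset.card_le_card hbiU
  rw [Finset.card_biUnion hdisj, hOXfcard] at h1
  have h2 : ∑ _T ∈ 𝒯₃, 2 ≤ ∑ T ∈ 𝒯₃, (OXf.filter (fun z => z ∈ T)).card := Finset.sum_le_sum hg2
  rw [Finset.sum_const, smul_eq_mul, h𝒯₃card] at h2
  omega

end S1

end PercRepro
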